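import Summits.FinalStateConjecture.FinalStateConjecture.Theorems.EIHFluxBalanceInertialRecessionStubEndgameOracleTightBallistic

/-!
# Route EIHFluxBalance — crux `InertialRecession`, line `sublinear-is-free-clean-window-charges`:
# the increment oracle for TIGHT member sets — assembly (`tight_increment`)

Helper file for the crux `stmt-FinalStateConjecture-10166`
(`Summit.FinalStateConjecture.FinalStateConjecture.Theses.EIHFluxBalance.InertialRecession`), registered stub
`stub_pairwiseDichotomy` / `stub_incrementOracle` (lead reshapes r7/r9) of
`Cruxes/InertialRecession/Lines/sublinear_is_free_clean_window_charges.lean`; continues `…OracleTight`, `…OracleTightBallistic`.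

`tight_increment`: window law + identification (instances for the threshold `ρ`, clearance `1/2`), centres with speed `≤ 1` after `T₀`
inside the cone `‖ξₐ(s)‖ ≤ κ²s`, a member set `S ∋ a` with nonempty complement all of whose outsiders stay at distance `≥ A₀` from `ξₐ`
and are BALLISTIC relative to `a` (floor `W/2`) on `[t₁,t₂]`, and TIGHTNESS — every member within `R/2` of `ξₐ` for the explicit radius
`R = min(c₀s, (2/3)·min_{j∉S}‖ξⱼ − ξₐ‖)`, `c₀ = (κ−κ²)/2`, with `ρ ≤ R/2` — imply
`|ΔE_S|, |ΔΠ_S^k| ≤ C·(2c₀^{-3/2}t₁^{-1/2} + |Sᶜ|·2·2√2·8/(W√A₀)) + ζ(t₁) + ζ(t₂)`: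
the radius is 2-Lipschitz (`abs_min_sub_min_le`, distances are 2-Lipschitz), the path `(ξₐ, R)` is admissible
(`increment_of_windowPath`), and its integral is `integral_radius_le`.
-/

noncomputable section

set_option linter.dupNamespace false

open Filter Topology Set MeasureTheory intervalIntegral
open scoped Topology BigOperators InnerProductSpace RealInnerProductSpace

namespace Summit.FinalStateConjecture.FinalStateConjecture.Theorems.SublinearIsFree.Oracle

open Literature.Geometry.Lorentzian
open Summit.FinalStateConjecture.FinalStateConjecture.Theorems.SublinearIsFree.Endgame
open Summit.FinalStateConjecture.FinalStateConjecture.Theorems.SublinearIsFree.Toy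

/-- Two-point Lipschitz bound for a minimum: `|min a b − min a′ b′| ≤ max |a − a′| |b − b′|`. [folklore] -/
theorem abs_min_sub_min_le (a b a' b' : ℝ) : |min a b - min a' b'| ≤ max |a - a'| |b - b'| := by
  rcases le_total a b with hab | hab <;> rcases le_total a' b' with hab' | hab' <;>
    simp only [min_eq_left, min_eq_right, hab, hab'] <;>
    [exact le_max_left _ _;
     (rw [abs_le]; constructor <;>
        [linarith [neg_abs_le (a - a'), le_max_left |a - a'| |b - b'|];
         linarith [le_abs_self (b - b'), le_max_right |a - a'| |b - b'|]]);
     (rw [abs_le]; constructor <;>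
        [linarith [neg_abs_le (b - b'), le_max_right |a - a'| |b - b'|];
         linarith [le_abs_self (a - a'), le_max_left |a - a'| |b - b'|]]);
     exact le_max_right _ _]

/-- Distances between centres moving at speed `≤ 1` after `T₀` are 2-Lipschitz (two-point form). [folklore] -/
theorem abs_dist_sub_dist_le_two {ξ₁ ξ₂ : ℝ → E3} (h₁ : Differentiable ℝ ξ₁) (h₂ : Differentiable ℝ ξ₂) {T₀ : ℝ}
    (hb₁ : ∀ t, T₀ ≤ t → ‖deriv ξ₁ t‖ ≤ 1) (hb₂ : ∀ t, T₀ ≤ t → ‖deriv ξ₂ t‖ ≤ 1)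
    {s s' : ℝ} (hs : T₀ ≤ s) (hs' : T₀ ≤ s') :
    |‖ξ₁ s - ξ₂ s‖ - ‖ξ₁ s' - ξ₂ s'‖| ≤ 2 * |s - s'| := by
  have hd : Differentiable ℝ (fun t ↦ ξ₁ t - ξ₂ t) := h₁.sub h₂
  have hb : ∀ t, T₀ ≤ t → ‖deriv (fun t ↦ ξ₁ t - ξ₂ t) t‖ ≤ 2 := by
    intro t ht
    have hder : deriv (fun t ↦ ξ₁ t - ξ₂ t) t = deriv ξ₁ t - deriv ξ₂ t :=
      ((h₁ t).hasDerivAt.sub (h₂ t).hasDerivAt).deriv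
    rw [hder]
    calc ‖deriv ξ₁ t - deriv ξ₂ t‖ ≤ ‖deriv ξ₁ t‖ + ‖deriv ξ₂ t‖ := norm_sub_le _ _
      _ ≤ 2 := by linarith [hb₁ t ht, hb₂ t ht]
  have hconv : Convex ℝ (Ici T₀) := convex_Ici T₀
  have h := hconv.norm_image_sub_le_of_norm_deriv_le (f := fun t ↦ ξ₁ t - ξ₂ t) (fun x _ ↦ hd.differentiableAt)
    (fun x hx ↦ hb x hx) hs' hs
  calc |‖ξ₁ s - ξ₂ s‖ - ‖ξ₁ s' - ξ₂ s'‖| ≤ ‖(ξ₁ s - ξ₂ s) - (ξ₁ s' - ξ₂ s')‖ := abs_norm_sub_norm_le _ _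
    _ ≤ 2 * ‖s - s'‖ := h
    _ = 2 * |s - s'| := by rw [Real.norm_eq_abs]

set_option maxHeartbeats 800000 in
/-- **THE INCREMENT ORACLE FOR A TIGHT MEMBER SET.** See the module docstring. [folklore] -/
theorem tight_increment {N : ℕ} (M : Fin N → ℝ) (ξ v : Fin N → ℝ → E3) (κ : ℝ) (P : ℝ → E3 → ℝ → Fin 4 → ℝ)
    (ρ : ℝ → ℝ) (C T T' T₀ : ℝ) (ζ : ℝ → ℝ)
    (hWL : ∀ (t₁ t₂ : ℝ) (c : ℝ → E3) (R : ℝ → ℝ), T ≤ t₁ → t₁ ≤ t₂ →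
      (∀ s ∈ Set.Icc t₁ t₂, ∀ s' ∈ Set.Icc t₁ t₂, ‖c s - c s'‖ ≤ 2 * |s - s'| ∧ |R s - R s'| ≤ 2 * |s - s'|) →
      (∀ s ∈ Set.Icc t₁ t₂, ρ s ≤ (1 / 2) * R s ∧ ‖c s‖ + R s ≤ (κ + κ ^ 2) / 2 * s ∧
        ∀ j, ‖ξ j s - c s‖ ≤ (1 - 1 / 2) * R s ∨ (1 + 1 / 2) * R s ≤ ‖ξ j s - c s‖) →
      ∀ μ : Fin 4, |P t₂ (c t₂) (R t₂) μ - P t₁ (c t₁) (R t₁) μ| ≤ C * ∫ s in t₁..t₂, (R s ^ (3 / 2 : ℝ))⁻¹)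
    (hID : ∀ (t : ℝ) (c : E3) (R : ℝ) (A : Finset (Fin N)), T' ≤ t → ρ t ≤ (1 / 2) * R →
      ‖c‖ + R ≤ (κ + κ ^ 2) / 2 * t →
      (∀ j, ‖ξ j t - c‖ ≤ (1 - 1 / 2) * R ∨ (1 + 1 / 2) * R ≤ ‖ξ j t - c‖) →
      (∀ j, j ∈ A ↔ ‖ξ j t - c‖ ≤ (1 - 1 / 2) * R) →
      |P t c R 0 - ∑ j ∈ A, M j * (√(1 - ‖v j t‖ ^ 2))⁻¹| ≤ ζ t ∧
      ∀ k : Fin 3, |P t c R k.succ - ∑ j ∈ A, M j * (√(1 - ‖v j t‖ ^ 2))⁻¹ * v j t k| ≤ ζ t)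
    (hC : 0 ≤ C) (hκ0 : 0 < κ) (hκ1 : κ < 1)
    (hξ : ∀ i, ContDiff ℝ 1 (ξ i)) (hspeed1 : ∀ i s, T₀ ≤ s → ‖deriv (ξ i) s‖ ≤ 1)
    {S : Finset (Fin N)} {a : Fin N} (hSc : (Finset.univ \ S).Nonempty)
    {t₁ t₂ W A₀ : ℝ} (hT : T ≤ t₁) (hT' : T' ≤ t₁) (hT₀ : T₀ ≤ t₁) (ht₁ : 0 < t₁) (h12 : t₁ ≤ t₂)
    (hW : 0 < W) (hA₀ : 0 < A₀)
    (hcone : ∀ s ∈ Set.Icc t₁ t₂, ‖ξ a s‖ ≤ κ ^ 2 * s)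
    (n : Fin N → E3) (hn : ∀ j ∈ Finset.univ \ S, ‖n j‖ = 1)
    (hball : ∀ j ∈ Finset.univ \ S, ∀ s ∈ Icc t₁ t₂, W / 2 ≤ ⟪deriv (ξ j) s - deriv (ξ a) s, n j⟫)
    (hfar : ∀ j ∈ Finset.univ \ S, ∀ s ∈ Icc t₁ t₂, A₀ ≤ ‖ξ j s - ξ a s‖)
    (hρ : ∀ s ∈ Set.Icc t₁ t₂,
      ρ s ≤ min ((κ - κ ^ 2) / 2 * s) (2 / 3 * (Finset.univ \ S).inf' hSc fun j ↦ ‖ξ j s - ξ a s‖) / 2)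
    (htight : ∀ s ∈ Set.Icc t₁ t₂, ∀ i ∈ S,
      ‖ξ i s - ξ a s‖ ≤ min ((κ - κ ^ 2) / 2 * s) (2 / 3 * (Finset.univ \ S).inf' hSc fun j ↦ ‖ξ j s - ξ a s‖) / 2) :
    |∑ j ∈ S, M j * (√(1 - ‖v j t₂‖ ^ 2))⁻¹ - ∑ j ∈ S, M j * (√(1 - ‖v j t₁‖ ^ 2))⁻¹| ≤
        C * (2 * (((κ - κ ^ 2) / 2) ^ (3 / 2 : ℝ))⁻¹ * (t₁ ^ (1 / 2 : ℝ))⁻¹ +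
          (Finset.univ \ S).card * (2 * (2 * √2 * (8 / (W * √A₀))))) + ζ t₁ + ζ t₂ ∧
    ∀ k : Fin 3, |∑ j ∈ S, M j * (√(1 - ‖v j t₂‖ ^ 2))⁻¹ * v j t₂ k - ∑ j ∈ S, M j * (√(1 - ‖v j t₁‖ ^ 2))⁻¹ * v j t₁ k| ≤
        C * (2 * (((κ - κ ^ 2) / 2) ^ (3 / 2 : ℝ))⁻¹ * (t₁ ^ (1 / 2 : ℝ))⁻¹ +
          (Finset.univ \ S).card * (2 * (2 * √2 * (8 / (W * √A₀))))) + ζ t₁ + ζ t₂ := by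
  classical
  set c₀ : ℝ := (κ - κ ^ 2) / 2 with hc₀def
  have hκκ : 0 < κ - κ ^ 2 := by nlinarith
  have hc₀ : 0 < c₀ := by positivity
  have hc₀1 : c₀ ≤ 1 := by rw [hc₀def]; nlinarith
  set Sc := Finset.univ \ S with hScdef
  set D : ℝ → ℝ := fun s ↦ Sc.inf' hSc fun j ↦ ‖ξ j s - ξ a s‖ with hD
  set R : ℝ → ℝ := fun s ↦ min (c₀ * s) (2 / 3 * D s) with hR
  have hdiff : ∀ i, Differentiable ℝ (ξ i) := fun i ↦ (hξ i).differentiable one_ne_zero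
  have hmemSc : ∀ j, j ∈ Sc ↔ j ∉ S := fun j ↦ by simp [hScdef]
  -- positivity of `D` and `R`
  have hDpos : ∀ s ∈ Set.Icc t₁ t₂, 0 < D s := by
    intro s hs
    obtain ⟨j, hj, hjmin⟩ := Finset.exists_mem_eq_inf' hSc (fun j ↦ ‖ξ j s - ξ a s‖)
    simp only [hD]; rw [hjmin]; exact hA₀.trans_le (hfar j hj s hs)
  have hRpos : ∀ s ∈ Set.Icc t₁ t₂, 0 < R s := fun s hs ↦
    lt_min (mul_pos hc₀ (ht₁.trans_le hs.1)) (by have := hDpos s hs; positivity)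
  -- `R` is 2-Lipschitz
  have hRlip : ∀ s ∈ Set.Icc t₁ t₂, ∀ s' ∈ Set.Icc t₁ t₂, |R s - R s'| ≤ 2 * |s - s'| := by
    intro s hs s' hs'
    have hDlip : |D s - D s'| ≤ 2 * |s - s'| :=
      abs_inf'_sub_inf'_le Sc hSc (fun j σ ↦ ‖ξ j σ - ξ a σ‖) fun j _ ↦
        abs_dist_sub_dist_le_two (hdiff j) (hdiff a) (fun t ht ↦ hspeed1 j t ht) (fun t ht ↦ hspeed1 a t ht)
          (hT₀.trans hs.1) (hT₀.trans hs'.1)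
    have h1 : |c₀ * s - c₀ * s'| ≤ 2 * |s - s'| := by
      rw [← mul_sub, abs_mul, abs_of_pos hc₀]
      have := abs_nonneg (s - s')
      nlinarith
    have h2 : |2 / 3 * D s - 2 / 3 * D s'| ≤ 2 * |s - s'| := by
      rw [← mul_sub, abs_mul, abs_of_pos (by norm_num : (0 : ℝ) < 2 / 3)]
      have := abs_nonneg (s - s')
      nlinarith
    calc |R s - R s'| ≤ max |c₀ * s - c₀ * s'| |2 / 3 * D s - 2 / 3 * D s'| := abs_min_sub_min_le _ _ _ _
      _ ≤ 2 * |s - s'| := max_le h1 h2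
  -- cone: `‖ξ a‖ + R ≤ (κ+κ²)s/2`
  have hcap : ∀ s ∈ Set.Icc t₁ t₂, ‖ξ a s‖ + R s ≤ (κ + κ ^ 2) / 2 * s := by
    intro s hs
    have h1 : R s ≤ c₀ * s := min_le_left _ _
    have h2 := hcone s hs
    have : κ ^ 2 * s + c₀ * s = (κ + κ ^ 2) / 2 * s := by rw [hc₀def]; ring
    linarith
  -- non-members beyond `3R/2`
  have hnon : ∀ s ∈ Set.Icc t₁ t₂, ∀ j ∉ S, 3 * R s / 2 ≤ ‖ξ j s - ξ a s‖ := by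
    intro s hs j hj
    have hj' : j ∈ Sc := (hmemSc j).mpr hj
    have h1 : R s ≤ 2 / 3 * D s := min_le_right _ _
    have h2 : D s ≤ ‖ξ j s - ξ a s‖ := Finset.inf'_le _ hj'
    linarith
  -- the increment along the explicit path
  have hinc := increment_of_windowPath M ξ v κ P ρ C T T' T₀ ζ hWL hID hdiff
    (fun i s hs ↦ (hspeed1 i s hs).trans (by norm_num)) hT hT' hT₀ h12 hRlip hRpos
    (fun s hs ↦ by simpa [hR, hD, hc₀def] using hρ s hs) hcap
    (fun s hs i hi ↦ by simpa [hR, hD, hc₀def] using htight s hs i hi) hnon (A := S) (a := a)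
  -- the integral of the radius
  have hint := integral_radius_le ξ hξ Sc hSc a ht₁ h12 hc₀ hW hA₀ n hn hball hfar
  have hIn : 0 ≤ ∫ s in t₁..t₂, (R s ^ (3 / 2 : ℝ))⁻¹ :=
    intervalIntegral.integral_nonneg h12 fun s hs ↦ inv_nonneg.mpr (Real.rpow_nonneg (hRpos s hs).le _)
  have hbound : C * (∫ s in t₁..t₂, (R s ^ (3 / 2 : ℝ))⁻¹) ≤
      C * (2 * (c₀ ^ (3 / 2 : ℝ))⁻¹ * (t₁ ^ (1 / 2 : ℝ))⁻¹ + Sc.card * (2 * (2 * √2 * (8 / (W * √A₀))))) :=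
    mul_le_mul_of_nonneg_left hint hC
  refine ⟨hinc.1.trans (by linarith), fun k ↦ (hinc.2 k).trans (by linarith)⟩

/-- Registered helper form of `abs_min_sub_min_le` (carrier of this file). [folklore] -/
theorem oracle_abs_min_sub_min_le : ∀ (a b a' b' : ℝ), |min a b - min a' b'| ≤ max |a - a'| |b - b'| :=
  fun a b a' b' ↦ abs_min_sub_min_le a b a' b'

end Summit.FinalStateConjecture.FinalStateConjecture.Theorems.SublinearIsFree.Oracle

end
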